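import Summits.ResolutionOfSingularities.ResolutionOfSingularities.Theorems.UniversalCellsUniversalityConfigDeductions

/-!
# Crux `Universality`, line `birth` — the normalised von Staudt encoding (registered stub)

Support file for crux stmt-ResolutionOfSingularities-15234 (`UniversalCells.Universality`), lead seat,
cycle 1: registered stub `stub_normalizedEncoding` —
`NormRing p (Kol N) (dRow N) (config N Eadd Emul Eone) ≃+* ElemRing p N Eadd Emul Eone`.

* `forward_vanish`: on the CANONICAL configuration (entries given by the template: constants
  `C1 = (1,1,0)`, `D1 = (1,0,1)`, `X = (0,−1,1)`, values `V_k = (x_k,1,0)`, gadget columns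
  `Qa_r = (x_j,0,1)`, `H_r = (x_i+x_j,1,1)`, `Qm_r = (x_j,0,1)`, `R_r = (0,−x_j,1)`,
  `Q'_r = (x_i x_j,0,1)`) over any ring in which the values satisfy the elementary relations, every
  minor listed in `config` vanishes (one determinant evaluation per family).
* `stub_normalizedEncoding`: the substitution `n_{ic} ↦ template(i,c)` maps `normIdeal` into
  `elemIdeal` (`forward_vanish` + designated template entries are `1`), the substitution
  `x_k ↦ n_{0,V_k}` maps `elemIdeal` into `normIdeal` (`dAdd`/`dMul`/`dOne` of the deductions file),
  and the induced algebra maps of the quotients (`Ideal.quotientMapₐ`) are inverse to each other on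
  generators because every entry is forced (`dC1 … dQ'`); `AlgEquiv.ofAlgHom`.

Sources: Lee–Vakil 2012 (arXiv:1202.3934) Thm 1.1 and §3; Mnëv 1988. No definition is declared (the
template is introduced inside the proof as an opaque function with nine evaluation rules).
-/

-- single-problem summit: the doubled namespace component `ResolutionOfSingularities` is forced
set_option linter.dupNamespace false

noncomputable section

namespace Summit.ResolutionOfSingularities.ResolutionOfSingularities.Theorems.UniversalCells

namespace NormEnc

open Matrix MvPolynomial

variable {R : Type} [CommRing R]
/-! ### The forward computation: the canonical configuration satisfies every imposed incidence -/

section Forward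
variable {N : ℕ} {Eadd Emul : Finset (Fin N × Fin N × Fin N)} {Eone : Finset (Fin N)}
variable {M : Matrix (Fin 3) (Fin 3 ⊕ (Unit ⊕ Kol N)) R} {x : Fin N → R}
  (hI : ∀ i j, M i (Sum.inl j) = (1 : Matrix (Fin 3) (Fin 3) R) i j)
  (hF : ∀ i, M i (Sum.inr (Sum.inl ())) = 1)
  (ht : ∀ (i : Fin 3) (c : Kol N), M i (Sum.inr (Sum.inr c)) =
      (fun ic : Fin 3 × Kol N =>
        Sum.elim (fun a : Fin 3 => (![![1, 1, 0], ![1, 0, 1], ![0, -1, 1]] : Fin 3 → Fin 3 → R) a ic.1)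
          (Sum.elim (fun k : Fin N => (![x k, 1, 0] : Fin 3 → R) ic.1)
            (Sum.elim
              (fun rk : (Fin N × Fin N × Fin N) × Fin 2 =>
                (![![x rk.1.2.1, 0, 1], ![x rk.1.1 + x rk.1.2.1, 1, 1]] : Fin 2 → Fin 3 → R) rk.2 ic.1)
              (fun rk : (Fin N × Fin N × Fin N) × Fin 3 =>
                (![![x rk.1.2.1, 0, 1], ![0, -x rk.1.2.1, 1], ![x rk.1.1 * x rk.1.2.1, 0, 1]] :
                  Fin 3 → Fin 3 → R) rk.2 ic.1)))
          ic.2) (i, c))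
  (hadd : ∀ r ∈ Eadd, x r.1 + x r.2.1 - x r.2.2 = 0)
  (hmul : ∀ r ∈ Emul, x r.1 * x r.2.1 - x r.2.2 = 0)
  (hone : ∀ i ∈ Eone, x i - 1 = 0)
include hI hF ht hadd hmul hone

/-- On the canonical normalised configuration with values `x` satisfying the elementary relations,
every minor imposed by `config` vanishes. [cite: LeeVakil2012, §3] -/
lemma forward_vanish : ∀ u ∈ config N Eadd Emul Eone, (M.submatrix id u).det = 0 := by
  intro u hu
  simp only [Set.mem_union, Set.mem_insert_iff, Set.mem_singleton_iff, Set.mem_range,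
    Set.mem_image, Finset.mem_coe] at hu
  rcases hu with ((((((((((((((h | h) | h) | h) | h) | h) | h) | h) | h) | h) | h) | h) | h) | h) | h)
  · rcases h with rfl | rfl | rfl | rfl | rfl | rfl
    · rw [det_entrySel_two M hI, ht]; simp
    · rw [det_e2_F M hI hF, ht, ht]; simp
    · rw [det_entrySel_one M hI, ht]; simp
    · rw [det_e1_F M hI hF, ht, ht]; simp
    · rw [det_entrySel_zero M hI, ht]; simp
    · rw [det_KKK M]; simp only [ht]; simp
  · obtain ⟨i, rfl⟩ := h
    rw [det_entrySel_two M hI, ht]; simp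
  · obtain ⟨i, hi, rfl⟩ := h
    rw [det_e2_F M hI hF, ht, ht]; simp; linear_combination -(hone i hi)
  · obtain ⟨r, rfl⟩ := h
    rw [det_entrySel_one M hI, ht]; simp
  · obtain ⟨r, rfl⟩ := h
    rw [det_KKK M]; simp only [ht]; simp
  · obtain ⟨r, rfl⟩ := h
    rw [det_e0_F M hI hF, ht, ht]; simp
  · obtain ⟨r, rfl⟩ := h
    rw [det_KKK M]; simp only [ht]; simp
  · obtain ⟨r, hr, rfl⟩ := h
    rw [det_e2_KK M hI]; simp only [ht]; simp; linear_combination -(hadd r hr)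
  · obtain ⟨r, rfl⟩ := h
    rw [det_entrySel_one M hI, ht]; simp
  · obtain ⟨r, rfl⟩ := h
    rw [det_KKK M]; simp only [ht]; simp
  · obtain ⟨r, rfl⟩ := h
    rw [det_entrySel_zero M hI, ht]; simp
  · obtain ⟨r, rfl⟩ := h
    rw [det_KKK M]; simp only [ht]; simp
  · obtain ⟨r, rfl⟩ := h
    rw [det_entrySel_one M hI, ht]; simp
  · obtain ⟨r, rfl⟩ := h
    rw [det_KKK M]; simp only [ht]; simp
  · obtain ⟨r, hr, rfl⟩ := h
    rw [det_KKK M]; simp only [ht]; simp; linear_combination -(hmul r hr)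

end Forward

end NormEnc

open NormEnc in
/-- **Registered stub `stub_normalizedEncoding`** (line `birth` of crux `UniversalCells.Universality`):
the normalised stratum ring of the von Staudt configuration of an elementary presentation IS the
elementary ring. The isomorphism is induced by the template substitution
`n_{ic} ↦ (canonical value of entry (i, c))` and, inversely, `x_k ↦ n_{0, V_k}`; both respect the
ideals (`forward_vanish`, resp. the deductions `dAdd`/`dMul`/`dOne`), and they are inverse because
every entry of the configuration is forced (`dC1` … `dQ'`). [cite: LeeVakil2012, Thm. 1.1, §3;
Mnev1988] -/
theorem stub_normalizedEncoding (p N : ℕ) (Eadd Emul : Finset (Fin N × Fin N × Fin N))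
    (Eone : Finset (Fin N)) :
    Nonempty (NormRing p (Kol N) (dRow N) (config N Eadd Emul Eone) ≃+*
      ElemRing p N Eadd Emul Eone) := by
  classical
  -- the template of canonical entries, kept opaque (`t`) with its nine evaluation rules
  obtain ⟨t, ht⟩ : ∃ t : Fin 3 × Kol N → MvPolynomial (Fin N) (ZMod p), t =
      (fun ic : Fin 3 × Kol N =>
        Sum.elim (fun a : Fin 3 => (![![1, 1, 0], ![1, 0, 1], ![0, -1, 1]] : Fin 3 → Fin 3 → MvPolynomial (Fin N) (ZMod p)) a ic.1)
          (Sum.elim (fun k : Fin N => (![MvPolynomial.X k, 1, 0] : Fin 3 → MvPolynomial (Fin N) (ZMod p)) ic.1)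
            (Sum.elim
              (fun rk : (Fin N × Fin N × Fin N) × Fin 2 =>
                (![![MvPolynomial.X rk.1.2.1, 0, 1], ![MvPolynomial.X rk.1.1 + MvPolynomial.X rk.1.2.1, 1, 1]] : Fin 2 → Fin 3 → MvPolynomial (Fin N) (ZMod p)) rk.2 ic.1)
              (fun rk : (Fin N × Fin N × Fin N) × Fin 3 =>
                (![![MvPolynomial.X rk.1.2.1, 0, 1], ![0, -MvPolynomial.X rk.1.2.1, 1], ![MvPolynomial.X rk.1.1 * MvPolynomial.X rk.1.2.1, 0, 1]] :
                  Fin 3 → Fin 3 → MvPolynomial (Fin N) (ZMod p)) rk.2 ic.1)))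
          ic.2) := ⟨_, rfl⟩
  have tC1 : ∀ i, t (i, Sum.inl 0) = (![1, 1, 0] : Fin 3 → _) i := fun i => by rw [ht]; rfl
  have tD1 : ∀ i, t (i, Sum.inl 1) = (![1, 0, 1] : Fin 3 → _) i := fun i => by rw [ht]; rfl
  have tX : ∀ i, t (i, Sum.inl 2) = (![0, -1, 1] : Fin 3 → _) i := fun i => by rw [ht]; rfl
  have tV : ∀ i k, t (i, Sum.inr (Sum.inl k)) = (![MvPolynomial.X k, 1, 0] : Fin 3 → _) i :=
    fun i k => by rw [ht]; rfl
  have tQa : ∀ i r, t (i, Sum.inr (Sum.inr (Sum.inl (r, 0)))) =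
      (![MvPolynomial.X r.2.1, 0, 1] : Fin 3 → _) i := fun i r => by rw [ht]; rfl
  have tH : ∀ i r, t (i, Sum.inr (Sum.inr (Sum.inl (r, 1)))) =
      (![MvPolynomial.X r.1 + MvPolynomial.X r.2.1, 1, 1] : Fin 3 → _) i := fun i r => by rw [ht]; rfl
  have tQm : ∀ i r, t (i, Sum.inr (Sum.inr (Sum.inr (r, 0)))) =
      (![MvPolynomial.X r.2.1, 0, 1] : Fin 3 → _) i := fun i r => by rw [ht]; rfl
  have tR : ∀ i r, t (i, Sum.inr (Sum.inr (Sum.inr (r, 1)))) =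
      (![0, -MvPolynomial.X r.2.1, 1] : Fin 3 → _) i := fun i r => by rw [ht]; rfl
  have tQ' : ∀ i r, t (i, Sum.inr (Sum.inr (Sum.inr (r, 2)))) =
      (![MvPolynomial.X r.1 * MvPolynomial.X r.2.1, 0, 1] : Fin 3 → _) i := fun i r => by rw [ht]; rfl
  clear ht
  -- the two substitutions between the polynomial rings
  let τ : MvPolynomial (Fin 3 × Kol N) (ZMod p) →ₐ[ZMod p] MvPolynomial (Fin N) (ZMod p) :=
    MvPolynomial.aeval t
  let σ : MvPolynomial (Fin N) (ZMod p) →ₐ[ZMod p] MvPolynomial (Fin 3 × Kol N) (ZMod p) :=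
    MvPolynomial.aeval fun k => MvPolynomial.X (0, (Sum.inr (Sum.inl k) : Kol N))
  have τX : ∀ ic, τ (MvPolynomial.X ic) = t ic := fun ic => MvPolynomial.aeval_X _ _
  have σX : ∀ k, σ (MvPolynomial.X k) = MvPolynomial.X (0, (Sum.inr (Sum.inl k) : Kol N)) :=
    fun k => MvPolynomial.aeval_X _ _
  set J := normIdeal p (Kol N) (dRow N) (config N Eadd Emul Eone) with hJ
  set E := elemIdeal p N Eadd Emul Eone with hE
  -- the configuration matrix over `Nr = P' ⧸ J` and its forced entries
  set MN : Matrix (Fin 3) (Fin 3 ⊕ (Unit ⊕ Kol N)) (MvPolynomial (Fin 3 × Kol N) (ZMod p) ⧸ J) :=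
    (normMatrix p (Kol N)).map (Ideal.Quotient.mk J) with hMN
  have nI : ∀ i j, MN i (Sum.inl j) = (1 : Matrix (Fin 3) (Fin 3) _) i j := by
    intro i j; by_cases h : i = j <;> simp [hMN, Matrix.one_apply, h]
  have nF : ∀ i, MN i (Sum.inr (Sum.inl ())) = 1 := by intro i; simp [hMN]
  have nent : ∀ (i : Fin 3) (c : Kol N),
      MN i (Sum.inr (Sum.inr c)) = Ideal.Quotient.mk J (MvPolynomial.X (i, c)) := by
    intro i c; simp [hMN]
  have nd : ∀ c : Kol N, MN (dRow N c) (Sum.inr (Sum.inr c)) = 1 := by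
    intro c
    have hmem : (MvPolynomial.X (dRow N c, c) - 1 : MvPolynomial (Fin 3 × Kol N) (ZMod p)) ∈ J :=
      Ideal.subset_span (Or.inl ⟨c, rfl⟩)
    rw [nent, ← map_one (Ideal.Quotient.mk J), Ideal.Quotient.eq]
    exact hmem
  have nv : ∀ u ∈ config N Eadd Emul Eone, (MN.submatrix id u).det = 0 := by
    intro u hu
    rw [hMN, Matrix.submatrix_map, ← RingHom.mapMatrix_apply, ← RingHom.map_det,
      Ideal.Quotient.eq_zero_iff_mem]
    exact Ideal.subset_span (Or.inr ⟨u, hu, rfl⟩)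
  -- (1) the template substitution maps `J` into `E`
  have h1 : J ≤ E.comap (τ : MvPolynomial (Fin 3 × Kol N) (ZMod p) →+* MvPolynomial (Fin N) (ZMod p)) := by
    rw [hJ, Ideal.span_le]
    rintro f (⟨c, rfl⟩ | ⟨u, hu, rfl⟩)
    · -- designated entries of the template are literally `1`
      rw [SetLike.mem_coe, Ideal.mem_comap, RingHom.coe_coe, map_sub, map_one, τX]
      rcases c with (a | k | ⟨r, k2⟩ | ⟨r, k3⟩)
      · fin_cases a
        · simp [tC1]
        · simp [tD1]
        · simp [tX]
      · simp [tV]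
      · fin_cases k2
        · simp [tQa]
        · simp [tH]
      · fin_cases k3
        · simp [tQm]
        · simp [tR]
        · simp [tQ']
    · -- imposed minors vanish on the canonical configuration over `B = PB ⧸ E`
      rw [SetLike.mem_coe, Ideal.mem_comap, RingHom.coe_coe, ← Ideal.Quotient.eq_zero_iff_mem]
      set MB : Matrix (Fin 3) (Fin 3 ⊕ (Unit ⊕ Kol N)) (MvPolynomial (Fin N) (ZMod p) ⧸ E) :=
        (normMatrix p (Kol N)).map ((Ideal.Quotient.mk E).comp (τ : _ →+* _)) with hMB
      have bent : ∀ (i : Fin 3) (c : Kol N),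
          MB i (Sum.inr (Sum.inr c)) = Ideal.Quotient.mk E (t (i, c)) := by
        intro i c; simp [hMB, τX]
      have key := forward_vanish (N := N) (Eadd := Eadd) (Emul := Emul) (Eone := Eone) (M := MB)
        (x := fun k => Ideal.Quotient.mk E (MvPolynomial.X k))
        (by intro i j; by_cases h : i = j <;> simp [hMB, Matrix.one_apply, h])
        (by intro i; simp [hMB])
        (by
          intro i c
          rw [bent]
          rcases c with (a | k | ⟨r, k2⟩ | ⟨r, k3⟩)
          · fin_cases a <;> fin_cases i <;> simp [tC1, tD1, tX]
          · fin_cases i <;> simp [tV]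
          · fin_cases k2 <;> fin_cases i <;> simp [tQa, tH]
          · fin_cases k3 <;> fin_cases i <;> simp [tQm, tR, tQ'])
        (by
          intro r hr
          rw [← map_add, ← map_sub, Ideal.Quotient.eq_zero_iff_mem, hE]
          exact Ideal.subset_span (Or.inl (Or.inl ⟨r, hr, rfl⟩)))
        (by
          intro r hr
          rw [← map_mul, ← map_sub, Ideal.Quotient.eq_zero_iff_mem, hE]
          exact Ideal.subset_span (Or.inl (Or.inr ⟨r, hr, rfl⟩)))
        (by
          intro i hi
          rw [← map_one (Ideal.Quotient.mk E), ← map_sub, Ideal.Quotient.eq_zero_iff_mem, hE]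
          exact Ideal.subset_span (Or.inr ⟨i, hi, rfl⟩))
        u hu
      rwa [hMB, Matrix.submatrix_map, ← RingHom.mapMatrix_apply, ← RingHom.map_det] at key
  -- (2) the value substitution maps `E` into `J`
  have h2 : E ≤ J.comap (σ : MvPolynomial (Fin N) (ZMod p) →+* MvPolynomial (Fin 3 × Kol N) (ZMod p)) := by
    rw [hE, Ideal.span_le]
    rintro f ((⟨r, hr, rfl⟩ | ⟨r, hr, rfl⟩) | ⟨i, hi, rfl⟩) <;>
      rw [SetLike.mem_coe, Ideal.mem_comap, RingHom.coe_coe, ← Ideal.Quotient.eq_zero_iff_mem]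
    · rw [map_sub, map_add, σX, σX, σX, map_sub, map_add, ← nent, ← nent, ← nent]
      exact dAdd nI nF nd nv r hr
    · rw [map_sub, map_mul, σX, σX, σX, map_sub, map_mul, ← nent, ← nent, ← nent]
      exact dMul nI nF nd nv r hr
    · rw [map_sub, map_one, σX, map_sub, map_one, ← nent]
      exact dOne nI nF nd nv i hi
  -- (3) the induced algebra maps between the quotients are mutually inverse
  let Φ := Ideal.quotientMapₐ E τ h1
  let Ψ := Ideal.quotientMapₐ J σ h2
  have ΦΨ : ∀ k : Fin N, Φ (Ψ (Ideal.Quotient.mk E (MvPolynomial.X k))) =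
      Ideal.Quotient.mk E (MvPolynomial.X k) := by
    intro k
    simp only [Φ, Ψ, Ideal.quotient_map_mkₐ, Ideal.Quotient.mkₐ_eq_mk, σX, τX, tV]
    rfl
  have ΨΦ : ∀ (i : Fin 3) (c : Kol N), Ψ (Φ (Ideal.Quotient.mk J (MvPolynomial.X (i, c)))) =
      Ideal.Quotient.mk J (MvPolynomial.X (i, c)) := by
    intro i c
    simp only [Φ, Ψ, Ideal.quotient_map_mkₐ, Ideal.Quotient.mkₐ_eq_mk, τX]
    have eC1 := dC1 nI nF nd nv
    have eD1 := dD1 nI nF nd nv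
    have eX := dX nI nF nd nv
    rcases c with (a | k | ⟨r, k2⟩ | ⟨r, k3⟩)
    · fin_cases a <;> fin_cases i
      · simpa [tC1, nent] using eC1.2.symm
      · simpa [tC1, nent] using (nd (Sum.inl 0)).symm
      · simpa [tC1, nent] using eC1.1.symm
      · simpa [tD1, nent] using eD1.2.symm
      · simpa [tD1, nent] using eD1.1.symm
      · simpa [tD1, nent] using (nd (Sum.inl 1)).symm
      · simpa [tX, nent] using eX.1.symm
      · simpa [tX, nent] using eX.2.symm
      · simpa [tX, nent] using (nd (Sum.inl 2)).symm
    · fin_cases i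
      · simp [tV, σX]
      · simpa [tV, nent] using (nd (Sum.inr (Sum.inl k))).symm
      · simpa [tV, nent] using (dV nI nv k).symm
    · have eQa := dQa nI nF nd nv r
      have eH := dH nI nF nd nv r
      fin_cases k2 <;> fin_cases i
      · simpa [tQa, σX, nent] using eQa.2.symm
      · simpa [tQa, nent] using eQa.1.symm
      · simpa [tQa, nent] using (nd (Sum.inr (Sum.inr (Sum.inl (r, 0))))).symm
      · simpa [tH, σX, nent] using eH.2.symm
      · simpa [tH, nent] using (nd (Sum.inr (Sum.inr (Sum.inl (r, 1))))).symm
      · simpa [tH, nent] using eH.1.symm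
    · have eQm := dQm nI nF nd nv r
      have eR := dR nI nF nd nv r
      have eQ' := dQ' nI nF nd nv r
      fin_cases k3 <;> fin_cases i
      · simpa [tQm, σX, nent] using eQm.2.symm
      · simpa [tQm, nent] using eQm.1.symm
      · simpa [tQm, nent] using (nd (Sum.inr (Sum.inr (Sum.inr (r, 0))))).symm
      · simpa [tR, nent] using eR.1.symm
      · simpa [tR, σX, nent] using eR.2.symm
      · simpa [tR, nent] using (nd (Sum.inr (Sum.inr (Sum.inr (r, 1))))).symm
      · simpa [tQ', σX, nent] using eQ'.2.symm
      · simpa [tQ', nent] using eQ'.1.symm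
      · simpa [tQ', nent] using (nd (Sum.inr (Sum.inr (Sum.inr (r, 2))))).symm
  have h3 : Φ.comp Ψ = AlgHom.id _ _ :=
    Ideal.Quotient.algHom_ext _ (MvPolynomial.algHom_ext fun k => by
      simpa [Ideal.Quotient.mkₐ_eq_mk] using ΦΨ k)
  have h4 : Ψ.comp Φ = AlgHom.id _ _ :=
    Ideal.Quotient.algHom_ext _ (MvPolynomial.algHom_ext fun ic => by
      simpa [Ideal.Quotient.mkₐ_eq_mk] using ΨΦ ic.1 ic.2)
  exact ⟨(AlgEquiv.ofAlgHom Φ Ψ h3 h4).toRingEquiv⟩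

end Summit.ResolutionOfSingularities.ResolutionOfSingularities.Theorems.UniversalCells

end
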